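import Summits.Ventures.CertifiedManyBodySolver.Downfold.RouterWordScore

/-!
# The v7 «structure-variant & P-axis controls» slate and the Bi P-axis columns: score-2's pre-registered
# router-word readings (PREREG Y84 / Y85, 2026-08-27) as kernel facts of the §4.2 score

Venture CertifiedManyBodySolver, cell `pub/hubbard-downfold`, seat hubbard-downfold-score-2 (g11); namespace
`Summit.Ventures.CertifiedManyBodySolver.Downfold.RouterScore` (REUSES `score`, `Head`, `Outcome` of `RouterWordScore.lean`,
the three-way-tested kernel form of ACCEPTANCE §4.2). Context: the validation-set v7 slate M191–M199 (lead VSET R20a…R20l) and two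
new P columns of M103 Bi (R-ci/R20m) were admitted on 2026-08-27 with EXPECTED router words typed by the curators BEFORE any
descriptor run, and the lead PRE-STATED the probable prints (R20h: M198 strained Sr₂RuO₄ words like bulk M48; R-cg (2): Y-124's
class-transferred U hull straddles θ ⇒ «UND:MIXED+1BH+3BE+…» probable; R-ci: Bi «EPH» ×2, an approximant-based column may add
«+SA»). score-2 registered, before any v7 word existed, what each such print SCORES by the letter (PREREG Y84 08:36Z, Y85 08:5xZ;
python engine `router_score.py score …`). This file is the kernel copy of those readings — so that the first v7 words (the FIRST one,
BOX #99 M195 La-fcc «UND:MIXED+EPH» 08:44:05Z, already printed PARTIAL exactly as registered) are compared with statements, not memory.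

WHAT THIS IS NOT: not a word, not a prediction that any material will print these words, and not a score of record (tranche
tables are cut once at the lead's «v7 / v3 CLOSE»). Every theorem is `decide` on closed terms of the §4 `Head` enum; material
names appear only in docstrings. One reading of Y84 (clause (v): an «UND:STRUCT» PRIMARY on Y-124 @10) was mis-worded «PARTIAL»
in the ledger and corrected by a dated erratum BEFORE any word — the kernel value is `ABSTAIN_structure` (`y124_structPrimary`).
-/

namespace Summit.Ventures.CertifiedManyBodySolver.Downfold

namespace RouterScore

open Head

/-! ## §1 v7 slate (PREREG Y84) -/

/-- M198 Sr₂RuO₄-strain100 (R20h/R20j): the lead's byte-identical print «UND:MULTIORB(k=3; J_H)+EPH» against the typed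
«UND:MULTIORB» ⇒ AGREE (MULTIORB head + EPH companion; the E33 FeSe/BaK122 precedent). [folklore] -/
theorem sr2ruo4_strain_identical_pair : score [undMultiorb, eph] [[undMultiorb]] = .AGREE := by decide

/-- M194 PdD (R20d (1)/R20g): BY-REFERENCE word of M67 PdH «UND:MIXED+1BH+EPH» against the typed «EPH» ⇒ PARTIAL (EPH emitted,
not primary) — inherited, not re-decided. [folklore] -/
theorem pdd_byref : score [undMixed, bh1, eph] [[eph]] = .PARTIAL := by decide

/-- M195 La-fcc (R20d (2)/R20g; BOX #99, the FIRST v7 word of record 2026-08-27T08:44:05Z): «UND:MIXED+EPH» against «EPH» ⇒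
PARTIAL; the other admissible print «EPH» ⇒ AGREE. [folklore] -/
theorem lafcc_mixed : score [undMixed, eph] [[eph]] = .PARTIAL ∧ score [eph] [[eph]] = .AGREE := by decide

/-- M197 La₃Ni₂O₇ film (R20e (2)/R20i): «UND:MULTIORB(…)+UND:STRUCT» or bare «UND:MULTIORB(…)» against
«UND:MULTIORB | UND:MULTIORB+UND:STRUCT» ⇒ AGREE either way. [folklore] -/
theorem la327film_pair : score [undMultiorb, undStruct] [[undMultiorb], [undMultiorb, undStruct]] = .AGREE
    ∧ score [undMultiorb] [[undMultiorb], [undMultiorb, undStruct]] = .AGREE := by decide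

/-- M199 YBa₂Cu₄O₈ (R-cg/R20l/R-ch/R-cj), Y84 (i): the plane-only word «1BH+3BE(+EPH)» and the routed-chain word
«1BH+3BE+UND:LATTICE(@chain)(+EPH)» against «1BH+3BE | 1BH+3BE+UND:LATTICE» ⇒ AGREE ×2. [folklore] -/
theorem y124_agree_shapes : score [bh1, be3, eph] [[bh1, be3], [bh1, be3, undLattice]] = .AGREE
    ∧ score [bh1, be3, undLattice, eph] [[bh1, be3], [bh1, be3, undLattice]] = .AGREE := by decide

/-- M199, Y84 (ii): the lead's PROBABLE print «UND:MIXED+1BH+3BE+EPH» (class-transferred U hull [2.51, 5.0] eV straddles θ) ⇒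
PARTIAL (1BH emitted, not primary) — with or without the chain's UND:LATTICE token. [folklore] -/
theorem y124_probable_mixed : score [undMixed, bh1, be3, eph] [[bh1, be3], [bh1, be3, undLattice]] = .PARTIAL
    ∧ score [undMixed, bh1, be3, undLattice, eph] [[bh1, be3], [bh1, be3, undLattice]] = .PARTIAL := by decide

/-- M199, Y84 (v) AS CORRECTED (§E erratum, before any word): an «UND:STRUCT» PRIMARY @10 ⇒ ABSTAIN_structure (no alternative
expects a structural head), whereas «UND:STRUCT» as a SECONDARY token leaves AGREE intact. [folklore] -/
theorem y124_structPrimary : score [undStruct, bh1, be3, eph] [[bh1, be3], [bh1, be3, undLattice]] = .ABSTAIN_structure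
    ∧ score [bh1, be3, undStruct] [[bh1, be3], [bh1, be3, undLattice]] = .AGREE := by decide

/-- M199, A10 treatment (β) print «1BH+3BE [INFL-Uschool]» (annotation is not a token) ⇒ AGREE; treatment (α) frozen
«UND:MIXED+1BH+3BE+EPH» ⇒ PARTIAL (= `y124_probable_mixed`). [folklore] -/
theorem y124_beta_alpha : score [bh1, be3] [[bh1, be3], [bh1, be3, undLattice]] = .AGREE
    ∧ score [undMixed, bh1, be3, eph] [[bh1, be3], [bh1, be3, undLattice]] = .PARTIAL := by decide

/-! ## §2 M103 Bi P-axis columns @2.65 / @3.2 (PREREG Y85 (a)) and the v7 third batch (Y85 (b)) -/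

/-- Bi @2.65 / @3.2 against «EPH | EPH+UND:STRUCT»: «EPH», «EPH+SA» (two approximants wording alike), «EPH+UND:STRUCT»,
«EPH+SA+UND:STRUCT» ⇒ AGREE ×4. [folklore] -/
theorem bi_columns_agree : score [eph] [[eph], [eph, undStruct]] = .AGREE ∧ score [eph, sa] [[eph], [eph, undStruct]] = .AGREE
    ∧ score [eph, undStruct] [[eph], [eph, undStruct]] = .AGREE ∧ score [eph, sa, undStruct] [[eph], [eph, undStruct]] = .AGREE := by
  decide

/-- Bi: an «UND:STRUCT…» PRIMARY (R0 only, or two approximants wording differently) ⇒ ABSTAIN_structure — the alternatives'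
heads are EPH, so a structural primary is not «expected» although «EPH+UND:STRUCT» is listed. [folklore] -/
theorem bi_structPrimary : score [undStruct, eph] [[eph], [eph, undStruct]] = .ABSTAIN_structure
    ∧ score [undStruct, undMixed, eph] [[eph], [eph, undStruct]] = .ABSTAIN_structure := by decide

/-- v7 third batch (R-cl = R20o; R-cp = R20p): Ga-beta / Hg-beta / PtH / RhH typed «EPH» — «EPH(+SA)» ⇒ AGREE; the one
informative-miss shape named in advance (a D3/D10-driven «UND:MIXED+EPH» on β-Hg or a moment-driven «UND:MULTIORB+EPH» on RhH)
⇒ PARTIAL; an «EPH»-less correlated word would be DISAGREE. [folklore] -/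
theorem v7_third_batch : score [eph, sa] [[eph]] = .AGREE ∧ score [undMixed, eph] [[eph]] = .PARTIAL
    ∧ score [undMultiorb, eph] [[eph]] = .PARTIAL ∧ score [undMultiorb] [[eph]] = .DISAGREE := by decide

end RouterScore

end Summit.Ventures.CertifiedManyBodySolver.Downfold
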